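import Summits.CriticalPhenomena.PercolationContinuityZ3.Theorems.PercNearOneGluingNoHeavyLowerTailSahiGridPatternHarris

/-!
# `NoHeavyLowerTail` (crux stmt-CriticalPhenomena-4575), Sahi programme: **NEGATIVE ASSOCIATION OF TOTALLY DISTINCT PAIRS ON
# `[3]^n`, EVERY DIMENSION** — `3^n · N(U;V) ≤ 2^n · |U| · |V|` for up-sets `U, V`

Support file (seat `prim-sahi-p1`, generation 15; `--supports stmt-CriticalPhenomena-4575`).  Pure proofs, no definitions, no `sorry`,
standard axioms.  Vocabulary of `…SahiGridPattern{,SliceForm,Harris}` (`Pd`, `TotDist`, `ind`, `sum_snoc`, the slices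
`{p : snoc p i ∈ U}`).

THE MATHEMATICS.  Write `N(U;V) = #{(p,q) ∈ U × V : p δ̸ q}` (pairs differing in EVERY axis).  A uniformly random totally distinct
pair `(y, y′)` of `[3]^n` (`6^n` of them) is a two-point LATIN HYPERCUBE SAMPLE: in each axis the two copies receive two distinct
values in uniformly random order.  Such a pair is NEGATIVELY ASSOCIATED (Joag-Dev–Proschan 1983, Thm. 2.11 + P₇; McKay–Beckman–
Conover 1979), whence for increasing events `P(y ∈ U, y′ ∈ V) ≤ P(y ∈ U) · P(y′ ∈ V)`, i.e. in counting form
  `N(U;V)/6^n ≤ (|U|/3^n)(|V|/3^n)`  ⟺  **`3^n · N(U;V) ≤ 2^n · |U| · |V|`**  (`three_pow_mul_tdPairs_le`).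
The abstract law-level statement is `Literature.Probability.LatticeModels.NegativeAssociation.lhsLaw_blocks_le`; here we give the
counting form in the programme's vocabulary with a direct proof by slicing the last axis (as for coefficientwise Harris
`tdPairs_le_card_inter`): `N_{n+1}(U,V) = Σ_{i≠j} N_n(U_i,V_j)`, the induction hypothesis on each block, and the three-term
CHEBYSHEV sum inequality `3·Σ_{i≠j} uᵢvⱼ ≤ 2·(Σᵢuᵢ)(Σⱼvⱼ)` for the nondecreasing slice cardinalities `uᵢ = |U_i|`, `vⱼ = |V_j|`
(`three_mul_offdiag_le_two_mul`).

ROLE IN THE PROGRAMME (census §41, W53).  Together with Harris on `[3]^n` (`|U ∩ V| · 3^n ≥ |U| · |V|`) this is the SANDWICH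
  `N(B_q;C_r) · 6^n ≤ (2^n|B_q|)(2^n|C_r|) ≤ 2^n|B_q ∩ C_r| · 6^n`
for the cell statistics `N2[q,r] = N(B_q;C_r)`, `T2[q,r] = 2^n|B_q ∩ C_r|` of the cell form `sStarD_cylSet_eq` of a junta cylinder:
a valid inequality for REALISABLE statistics that is quadratic in the fibre marginals and therefore NOT among the atoms of the uniform
certificate cone `cone(H) + (K*⊗K*)_T + (K*⊗K*)_N` (whose k = 4 instance was shown insufficient by the census, 2026-08-22); its linear
shadow is only coefficientwise Harris `N2 ≤ T2`.  It refines coefficientwise Harris by the factor `|U||V| / (3^n |U ∩ V|) ≤ 1`.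
Nothing here asserts `PatternPos d` for `d ≥ 4`. [this work]
-/

namespace Summit.CriticalPhenomena.PercolationContinuityZ3.Theorems.SahiGridPattern

open Finset SahiGrid3
open scoped BigOperators

variable {n : ℕ}

/-- **Chebyshev's sum inequality, three terms, off-diagonal form**: for nondecreasing `u₀ ≤ u₁ ≤ u₂` and `v₀ ≤ v₁ ≤ v₂`,
`3 · Σ_{i≠j} uᵢ vⱼ ≤ 2 · (Σᵢ uᵢ)(Σⱼ vⱼ)` (equivalently `(Σu)(Σv) ≤ 3 Σᵢ uᵢvᵢ`). [this work] -/
theorem three_mul_offdiag_le_two_mul (u0 u1 u2 v0 v1 v2 : ℤ) (hu01 : u0 ≤ u1) (hu12 : u1 ≤ u2) (hv01 : v0 ≤ v1) (hv12 : v1 ≤ v2) :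
    3 * (u0 * v1 + u0 * v2 + u1 * v0 + u1 * v2 + u2 * v0 + u2 * v1) ≤ 2 * ((u0 + u1 + u2) * (v0 + v1 + v2)) := by
  nlinarith [mul_nonneg (sub_nonneg.2 hu01) (sub_nonneg.2 hv01), mul_nonneg (sub_nonneg.2 hu12) (sub_nonneg.2 hv12),
    mul_nonneg (sub_nonneg.2 (hu01.trans hu12)) (sub_nonneg.2 (hv01.trans hv12))]

/-- `Σ_p 1_U(p) = #U` (bookkeeping). [this work] -/
theorem sum_ind_eq_card {Y : Type*} [Fintype Y] [DecidableEq Y] (U : Finset Y) : (∑ p, ind U p) = (U.card : ℤ) := by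
  unfold ind
  rw [Finset.sum_boole, Finset.filter_mem_eq_inter, Finset.univ_inter]

/-- Slice cardinalities of an up-set of `[3]^{n+1}` are nondecreasing in the level (bookkeeping). [this work] -/
theorem sum_ind_filter_snoc_mono {U : Finset (Pd (n + 1))} (hU : IsUpperSet (U : Set (Pd (n + 1)))) {i j : Fin 3} (hij : i ≤ j) :
    (∑ p : Pd n, ind (univ.filter fun q : Pd n => (Fin.snoc q i : Pd (n + 1)) ∈ U) p) ≤
      ∑ p : Pd n, ind (univ.filter fun q : Pd n => (Fin.snoc q j : Pd (n + 1)) ∈ U) p :=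
  Finset.sum_le_sum fun p _ => by
    rw [ind_filter_snoc U i p, ind_filter_snoc U j p]
    exact ind_snoc_mono hU p hij

/-- **Negative association of totally distinct pairs on `[3]^n`, indicator form** (every `n`): for up-sets `U, V`,
`3^n · Σ_{p,q} 1_U(p) 1_V(q) [p δ̸ q] ≤ 2^n · (Σ_p 1_U(p)) · (Σ_q 1_V(q))`. [this work] -/
theorem three_pow_mul_sum_ind_totDist_le : ∀ (n : ℕ) (U V : Finset (Pd n)), IsUpperSet (U : Set (Pd n)) → IsUpperSet (V : Set (Pd n)) →
    3 ^ n * (∑ p, ∑ q, ind U p * ind V q * (if TotDist p q = true then (1 : ℤ) else 0)) ≤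
      2 ^ n * ((∑ p, ind U p) * (∑ q, ind V q)) := by
  intro n
  induction n with
  | zero =>
    intro U V _ _
    have hsub : ∀ p q : Pd 0, p = q := fun p q => funext fun a => a.elim0
    have huniv : (Finset.univ : Finset (Pd 0)) = {fun a => a.elim0} := by
      ext p; simp only [mem_univ, mem_singleton, true_iff]; exact hsub _ _
    have htd : TotDist (fun a : Fin 0 => a.elim0) (fun a : Fin 0 => a.elim0) = true := by
      rw [totDist_iff]; intro a; exact a.elim0
    simp only [huniv, Finset.sum_singleton, pow_zero, one_mul, htd, if_true, mul_one, le_refl]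
  | succ n ih =>
    intro U V hU hV
    set Us : Fin 3 → Finset (Pd n) := fun i => univ.filter fun p : Pd n => (Fin.snoc p i : Pd (n + 1)) ∈ U with hUs
    set Vs : Fin 3 → Finset (Pd n) := fun i => univ.filter fun p : Pd n => (Fin.snoc p i : Pd (n + 1)) ∈ V with hVs
    have hU' : ∀ i p, ind U (Fin.snoc p i) = ind (Us i) p := fun i p => (ind_filter_snoc U i p).symm
    have hV' : ∀ i p, ind V (Fin.snoc p i) = ind (Vs i) p := fun i p => (ind_filter_snoc V i p).symm
    have htd : ∀ (p q : Pd n) (i j : Fin 3), (if TotDist (Fin.snoc p i : Pd (n + 1)) (Fin.snoc q j) = true then (1 : ℤ) else 0) =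
        (if TotDist p q = true then (1 : ℤ) else 0) * (if i ≠ j then 1 else 0) := by
      intro p q i j
      by_cases h1 : TotDist p q = true
      · by_cases h2 : i ≠ j
        · rw [if_pos ((totDist_snoc_iff p q i j).2 ⟨h1, h2⟩), if_pos h1, if_pos h2]; ring
        · rw [if_neg (fun h => h2 ((totDist_snoc_iff p q i j).1 h).2), if_pos h1, if_neg h2]; ring
      · rw [if_neg (fun h => h1 ((totDist_snoc_iff p q i j).1 h).1), if_neg h1]; ring
    -- slice the pair count
    have hL : (∑ p : Pd (n + 1), ∑ q : Pd (n + 1), ind U p * ind V q * (if TotDist p q = true then (1 : ℤ) else 0)) =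
        ∑ i : Fin 3, ∑ j : Fin 3, (if i ≠ j then (1 : ℤ) else 0) *
          (∑ p : Pd n, ∑ q : Pd n, ind (Us i) p * ind (Vs j) q * (if TotDist p q = true then (1 : ℤ) else 0)) := by
      rw [sum_snoc (fun p : Pd (n + 1) => ∑ q : Pd (n + 1), ind U p * ind V q * (if TotDist p q = true then (1 : ℤ) else 0))]
      refine Finset.sum_congr rfl fun i _ => ?_
      have inner : ∀ p : Pd n, (∑ q : Pd (n + 1), ind U (Fin.snoc p i) * ind V q *
          (if TotDist (Fin.snoc p i : Pd (n + 1)) q = true then (1 : ℤ) else 0)) =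
          ∑ j : Fin 3, ∑ q : Pd n, (if i ≠ j then (1 : ℤ) else 0) *
            (ind (Us i) p * ind (Vs j) q * (if TotDist p q = true then (1 : ℤ) else 0)) := by
        intro p
        rw [sum_snoc (fun q : Pd (n + 1) => ind U (Fin.snoc p i) * ind V q *
          (if TotDist (Fin.snoc p i : Pd (n + 1)) q = true then (1 : ℤ) else 0))]
        refine Finset.sum_congr rfl fun j _ => Finset.sum_congr rfl fun q _ => ?_
        rw [hU', hV', htd]; ring
      rw [Finset.sum_congr rfl fun p _ => inner p, Finset.sum_comm]
      refine Finset.sum_congr rfl fun j _ => ?_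
      rw [Finset.mul_sum]
      refine Finset.sum_congr rfl fun p _ => ?_
      rw [Finset.mul_sum]
    -- slice the two cardinalities
    have hRU : (∑ p : Pd (n + 1), ind U p) = ∑ i : Fin 3, ∑ p : Pd n, ind (Us i) p := by
      rw [sum_snoc (fun p : Pd (n + 1) => ind U p)]
      refine Finset.sum_congr rfl fun i _ => Finset.sum_congr rfl fun p _ => ?_
      rw [hU']
    have hRV : (∑ q : Pd (n + 1), ind V q) = ∑ j : Fin 3, ∑ q : Pd n, ind (Vs j) q := by
      rw [sum_snoc (fun q : Pd (n + 1) => ind V q)]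
      refine Finset.sum_congr rfl fun j _ => Finset.sum_congr rfl fun q _ => ?_
      rw [hV']
    rw [hL, hRU, hRV]
    -- abbreviations for the block quantities
    set N : Fin 3 → Fin 3 → ℤ := fun i j =>
      ∑ p : Pd n, ∑ q : Pd n, ind (Us i) p * ind (Vs j) q * (if TotDist p q = true then (1 : ℤ) else 0) with hN
    set u : Fin 3 → ℤ := fun i => ∑ p : Pd n, ind (Us i) p with hu
    set v : Fin 3 → ℤ := fun j => ∑ q : Pd n, ind (Vs j) q with hv
    -- induction hypothesis on each block
    have hblock : ∀ i j : Fin 3, 3 ^ n * N i j ≤ 2 ^ n * (u i * v j) := fun i j =>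
      ih (Us i) (Vs j) (by rw [hUs]; exact isUpperSet_filter_snoc hU i) (by rw [hVs]; exact isUpperSet_filter_snoc hV j)
    -- monotonicity of the slice cardinalities
    have hu01 : u 0 ≤ u 1 := sum_ind_filter_snoc_mono hU (by decide)
    have hu12 : u 1 ≤ u 2 := sum_ind_filter_snoc_mono hU (by decide)
    have hv01 : v 0 ≤ v 1 := sum_ind_filter_snoc_mono hV (by decide)
    have hv12 : v 1 ≤ v 2 := sum_ind_filter_snoc_mono hV (by decide)
    have cheb := three_mul_offdiag_le_two_mul (u 0) (u 1) (u 2) (v 0) (v 1) (v 2) hu01 hu12 hv01 hv12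
    have h01 : ((0 : Fin 3) = 1) = False := by decide
    have h02 : ((0 : Fin 3) = 2) = False := by decide
    have h10 : ((1 : Fin 3) = 0) = False := by decide
    have h12 : ((1 : Fin 3) = 2) = False := by decide
    have h20 : ((2 : Fin 3) = 0) = False := by decide
    have h21 : ((2 : Fin 3) = 1) = False := by decide
    show 3 ^ (n + 1) * ∑ i : Fin 3, ∑ j : Fin 3, (if i ≠ j then (1 : ℤ) else 0) * N i j ≤
      2 ^ (n + 1) * ((∑ i : Fin 3, u i) * (∑ j : Fin 3, v j))
    simp only [Fin.sum_univ_three, ne_eq, not_true_eq_false, if_false, zero_mul, zero_add, add_zero,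
      h01, h02, h10, h12, h20, h21, not_false_eq_true, if_true, one_mul]
    have b01 := hblock 0 1
    have b02 := hblock 0 2
    have b10 := hblock 1 0
    have b12 := hblock 1 2
    have b20 := hblock 2 0
    have b21 := hblock 2 1
    have h3 : (0 : ℤ) ≤ 3 ^ n := pow_nonneg (by norm_num) n
    have h2 : (0 : ℤ) ≤ 2 ^ n := pow_nonneg (by norm_num) n
    rw [pow_succ, pow_succ]
    nlinarith [mul_le_mul_of_nonneg_left cheb h2, b01, b02, b10, b12, b20, b21, h3, h2]

/-- **NEGATIVE ASSOCIATION OF TOTALLY DISTINCT PAIRS ON `[3]^n`** (every `n`): for up-sets `U, V ⊆ [3]^n` the number `N(U;V)` of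
pairs `(p,q) ∈ U × V` that differ in every axis satisfies `3^n · N(U;V) ≤ 2^n · #U · #V` — i.e. for the uniform totally distinct pair
(two-point Latin hypercube sample) `P(y ∈ U, y′ ∈ V) ≤ P(y ∈ U) · P(y′ ∈ V)` (Joag-Dev–Proschan 1983, Thm. 2.11 with P₇; counting
form and direct proof by slicing here). [this work] -/
theorem three_pow_mul_tdPairs_le (U V : Finset (Pd n)) (hU : IsUpperSet (U : Set (Pd n))) (hV : IsUpperSet (V : Set (Pd n))) :
    (3 : ℤ) ^ n * (((U ×ˢ V).filter fun pq => TotDist pq.1 pq.2 = true).card : ℤ) ≤ 2 ^ n * ((U.card : ℤ) * (V.card : ℤ)) := by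
  rw [← sum_sum_ind_totDist_eq_card, ← sum_ind_eq_card U, ← sum_ind_eq_card V]
  exact three_pow_mul_sum_ind_totDist_le n U V hU hV

/-- **The sandwich with coefficientwise Harris**: negative association refines `N(U;V) ≤ 2^n · #(U ∩ V)` through the FKG/Harris
inequality `#U · #V ≤ 3^n · #(U ∩ V)` whenever the latter is available; stated here as the implication actually used downstream:
if `#U · #V ≤ 3^n · #(U ∩ V)` then `3^n · N(U;V) ≤ 6^n · #(U ∩ V)`. [this work] -/
theorem three_pow_mul_tdPairs_le_of_harris (U V : Finset (Pd n)) (hU : IsUpperSet (U : Set (Pd n))) (hV : IsUpperSet (V : Set (Pd n)))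
    (hFKG : (U.card : ℤ) * (V.card : ℤ) ≤ 3 ^ n * ((U ∩ V).card : ℤ)) :
    (3 : ℤ) ^ n * (((U ×ˢ V).filter fun pq => TotDist pq.1 pq.2 = true).card : ℤ) ≤ 6 ^ n * ((U ∩ V).card : ℤ) := by
  have h := three_pow_mul_tdPairs_le U V hU hV
  have h2 : (0 : ℤ) ≤ 2 ^ n := pow_nonneg (by norm_num) n
  have h6 : (6 : ℤ) ^ n = 2 ^ n * 3 ^ n := by rw [← mul_pow]; norm_num
  rw [h6, mul_assoc]
  exact h.trans (mul_le_mul_of_nonneg_left hFKG h2)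


/-! ### Appendix (same generation): FKG/Harris on `[3]^n` in counting form, and the unconditional sandwich -/

/-- **Chebyshev's sum inequality, three terms, diagonal form**: for nondecreasing `u₀ ≤ u₁ ≤ u₂`, `v₀ ≤ v₁ ≤ v₂`,
`(Σᵢ uᵢ)(Σⱼ vⱼ) ≤ 3 · Σᵢ uᵢ vᵢ`. [this work] -/
theorem sum_mul_sum_le_three_mul_diag (u0 u1 u2 v0 v1 v2 : ℤ) (hu01 : u0 ≤ u1) (hu12 : u1 ≤ u2) (hv01 : v0 ≤ v1) (hv12 : v1 ≤ v2) :
    (u0 + u1 + u2) * (v0 + v1 + v2) ≤ 3 * (u0 * v0 + u1 * v1 + u2 * v2) := by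
  have h := three_mul_offdiag_le_two_mul u0 u1 u2 v0 v1 v2 hu01 hu12 hv01 hv12
  nlinarith [h]

/-- **FKG / Harris on `[3]^n`, counting form** (every `n`): for up-sets `U, V ⊆ [3]^n`,
`(Σ_p 1_U(p)) · (Σ_q 1_V(q)) ≤ 3^n · Σ_p 1_U(p) 1_V(p)`, i.e. `P(U) P(V) ≤ P(U ∩ V)` for the uniform (product) weight — proved by
slicing the last axis and Chebyshev's sum inequality (the classical one-coordinate-at-a-time proof of Harris' inequality). [this work] -/
theorem sum_ind_mul_sum_ind_le : ∀ (n : ℕ) (U V : Finset (Pd n)), IsUpperSet (U : Set (Pd n)) → IsUpperSet (V : Set (Pd n)) →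
    (∑ p, ind U p) * (∑ q, ind V q) ≤ 3 ^ n * ∑ p, ind U p * ind V p := by
  intro n
  induction n with
  | zero =>
    intro U V _ _
    have hsub : ∀ p q : Pd 0, p = q := fun p q => funext fun a => a.elim0
    have huniv : (Finset.univ : Finset (Pd 0)) = {fun a => a.elim0} := by
      ext p; simp only [mem_univ, mem_singleton, true_iff]; exact hsub _ _
    simp only [huniv, Finset.sum_singleton, pow_zero, one_mul, le_refl]
  | succ n ih =>
    intro U V hU hV
    set Us : Fin 3 → Finset (Pd n) := fun i => univ.filter fun p : Pd n => (Fin.snoc p i : Pd (n + 1)) ∈ U with hUs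
    set Vs : Fin 3 → Finset (Pd n) := fun i => univ.filter fun p : Pd n => (Fin.snoc p i : Pd (n + 1)) ∈ V with hVs
    have hU' : ∀ i p, ind U (Fin.snoc p i) = ind (Us i) p := fun i p => (ind_filter_snoc U i p).symm
    have hV' : ∀ i p, ind V (Fin.snoc p i) = ind (Vs i) p := fun i p => (ind_filter_snoc V i p).symm
    have hRU : (∑ p : Pd (n + 1), ind U p) = ∑ i : Fin 3, ∑ p : Pd n, ind (Us i) p := by
      rw [sum_snoc (fun p : Pd (n + 1) => ind U p)]
      refine Finset.sum_congr rfl fun i _ => Finset.sum_congr rfl fun p _ => ?_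
      rw [hU']
    have hRV : (∑ q : Pd (n + 1), ind V q) = ∑ j : Fin 3, ∑ q : Pd n, ind (Vs j) q := by
      rw [sum_snoc (fun q : Pd (n + 1) => ind V q)]
      refine Finset.sum_congr rfl fun j _ => Finset.sum_congr rfl fun q _ => ?_
      rw [hV']
    have hD : (∑ p : Pd (n + 1), ind U p * ind V p) = ∑ i : Fin 3, ∑ p : Pd n, ind (Us i) p * ind (Vs i) p := by
      rw [sum_snoc (fun p : Pd (n + 1) => ind U p * ind V p)]
      refine Finset.sum_congr rfl fun i _ => Finset.sum_congr rfl fun p _ => ?_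
      rw [hU', hV']
    rw [hRU, hRV, hD]
    set u : Fin 3 → ℤ := fun i => ∑ p : Pd n, ind (Us i) p with hu
    set v : Fin 3 → ℤ := fun j => ∑ q : Pd n, ind (Vs j) q with hv
    set w : Fin 3 → ℤ := fun i => ∑ p : Pd n, ind (Us i) p * ind (Vs i) p with hw
    have hblock : ∀ i : Fin 3, u i * v i ≤ 3 ^ n * w i := fun i =>
      ih (Us i) (Vs i) (by rw [hUs]; exact isUpperSet_filter_snoc hU i) (by rw [hVs]; exact isUpperSet_filter_snoc hV i)
    have hu01 : u 0 ≤ u 1 := sum_ind_filter_snoc_mono hU (by decide)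
    have hu12 : u 1 ≤ u 2 := sum_ind_filter_snoc_mono hU (by decide)
    have hv01 : v 0 ≤ v 1 := sum_ind_filter_snoc_mono hV (by decide)
    have hv12 : v 1 ≤ v 2 := sum_ind_filter_snoc_mono hV (by decide)
    have cheb := sum_mul_sum_le_three_mul_diag (u 0) (u 1) (u 2) (v 0) (v 1) (v 2) hu01 hu12 hv01 hv12
    show (∑ i : Fin 3, u i) * (∑ j : Fin 3, v j) ≤ 3 ^ (n + 1) * ∑ i : Fin 3, w i
    simp only [Fin.sum_univ_three]
    have b0 := hblock 0
    have b1 := hblock 1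
    have b2 := hblock 2
    rw [pow_succ]
    nlinarith [b0, b1, b2, cheb]

/-- **FKG / HARRIS ON `[3]^n`** (counting form, every `n`): for up-sets `U, V ⊆ [3]^n`, `#U · #V ≤ 3^n · #(U ∩ V)`. [this work] -/
theorem card_mul_card_le_three_pow_mul_card_inter (U V : Finset (Pd n)) (hU : IsUpperSet (U : Set (Pd n)))
    (hV : IsUpperSet (V : Set (Pd n))) : (U.card : ℤ) * (V.card : ℤ) ≤ 3 ^ n * ((U ∩ V).card : ℤ) := by
  rw [← sum_ind_eq_card U, ← sum_ind_eq_card V, ← sum_ind_mul_ind_eq_card]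
  exact sum_ind_mul_sum_ind_le n U V hU hV

/-- **THE SANDWICH, unconditional** (every `n`): for up-sets `U, V ⊆ [3]^n`,
`3^n · N(U;V) ≤ 2^n · #U · #V ≤ 6^n · #(U ∩ V)` — negative association of the totally distinct pair followed by FKG; the composite
`N(U;V) ≤ 2^n #(U ∩ V)` is coefficientwise Harris (`tdPairs_le_card_inter`), so this factors the two-copy pattern inequality through the
product of the marginals. [this work] -/
theorem three_pow_mul_tdPairs_le_six_pow_mul_card_inter (U V : Finset (Pd n)) (hU : IsUpperSet (U : Set (Pd n)))
    (hV : IsUpperSet (V : Set (Pd n))) :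
    (3 : ℤ) ^ n * (((U ×ˢ V).filter fun pq => TotDist pq.1 pq.2 = true).card : ℤ) ≤ 2 ^ n * ((U.card : ℤ) * (V.card : ℤ)) ∧
      2 ^ n * ((U.card : ℤ) * (V.card : ℤ)) ≤ 6 ^ n * ((U ∩ V).card : ℤ) := by
  refine ⟨three_pow_mul_tdPairs_le U V hU hV, ?_⟩
  have h2 : (0 : ℤ) ≤ 2 ^ n := pow_nonneg (by norm_num) n
  have h6 : (6 : ℤ) ^ n = 2 ^ n * 3 ^ n := by rw [← mul_pow]; norm_num
  rw [h6, mul_assoc]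
  exact mul_le_mul_of_nonneg_left (card_mul_card_le_three_pow_mul_card_inter U V hU hV) h2

end Summit.CriticalPhenomena.PercolationContinuityZ3.Theorems.SahiGridPattern
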